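import Summits.HodgeConjecture.HodgeConjecture.Theorems.UHeadUa                                  -- ★ (C) p728281: `UHead.Ua_holds_of_residual` (U-a half)
import Summits.HodgeConjecture.HodgeConjecture.Theorems.UHeadGlue                                -- ★ glue PART 2 p729142: `HypDel.UHead.glue_core (hF)`
import Summits.HodgeConjecture.HodgeConjecture.Theorems.UeP4OfF                                  -- ★ (P4 chain head, B-p03 (g14)): `UeP4OfF.ue_P4_of_F (hF)`
import Summits.HodgeConjecture.HodgeConjecture.Theorems.SiegelClassifyEqOfAdmissible             -- ★ P6 p723133: `HypDel.UHead.classifyingMap_eq_of_isAdmissibleAt`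
import Literature.AlgebraicGeometry.ModuliOfAbelianVarieties.SiegelClassifyingMapLocalInverse    -- ★ P5 p722754: `siegelClassifyingMap_clauses_of_localInverse`
import Literature.AlgebraicGeometry.Motives.PoincareUniversal.Residual                           -- ★ M13 p732754: `Motives.AbelianVariety.U_a3_residual_of_M13`
import Literature.AlgebraicGeometry.ModuliOfAbelianVarieties.SiegelFineModuliSchemeRelDim       -- ★ (F′) (B-p01 (g13), Y-E2 s164): `lan2013_siegelFineModuliScheme_relDim`, `lan2013_of_relDim`, `smoothOfRelativeDimension_of_relDim`
import HarnessLib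

/-!
# (U) from (F) and equidimensionality: the complex uniformisation of the Siegel fine moduli scheme

Sub-problem `HodgeConjecture` (cell HC_CM, binder hDel, (U) lane; registry `Cruxes/HDel/Lines/F1ExtHodgeType.lean` `stub_U`).
The tree home of the (U) closer: the cell's (U) head (B-plan2's HOME skeleton `U-HEAD-skeleton` v0.21/v0.22, statement of
record `U_of (hF) (hM13) (hE)`) read BY IMPORT of its ★ parts — the U-a half ★ `UHead.Ua_holds_of_residual` at the M13
residual ★ `Motives.AbelianVariety.U_a3_residual_of_M13` ([MumfordAV1970] §13), the U-e second layer P4 ★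
`UeP4OfF.ue_P4_of_F` ([LangeBirkenhake1992] §8.1) / P5 ★ `siegelClassifyingMap_clauses_of_localInverse`
([FritzscheGrauert2002] I §8) / P6 ★ `HypDel.UHead.classifyingMap_eq_of_isAdmissibleAt` ([Milne2005ShimuraVarieties] Thm. 6.11),
and the glue ★ `HypDel.UHead.glue_core` ([MumfordFogartyKirwan1994] App. 7A) — with NO home-made definition: the
equidimensionality input EQUIDIM («every `𝓜_{g,δ,N}` is smooth over `ℚ` of relative dimension `g(g+1)/2`»,
[GortzWedhorn2023] Thm. 27.301) is an UNFOLDED binder.  Main results: `ue_of_F_of_equidim` (the U-e socket text of the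
glue from (F) + EQUIDIM — the skeleton's `Ue_of`, ported), `U_of_F (hF) (hE) : siegelModuli_complexUniformisation` (the N0 head:
EQUIDIM as an unfolded binder) and `U_of_relDim_F (hF′) : siegelModuli_complexUniformisation` (the Y-E2 head, director s164: (U)
from the single printed fact (F′) ★ `lan2013_siegelFineModuliScheme_relDim` = (F) WITH its printed relative dimension
`g(g+1)/2`, [GortzWedhorn2023] Thm. 27.301, via ★ `lan2013_of_relDim` / ★ `smoothOfRelativeDimension_of_relDim`).
HC_CM is proved only modulo the 7 printed citations until rung 0 closes; this helper changes no count by itself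
(it is the tree home from which the (e-F) edition / registry v5.2 read `stub_U`).

## References
* [MumfordFogartyKirwan1994] D. Mumford, J. Fogarty, F. Kirwan, *Geometric Invariant Theory*, 3rd ed., Appendix to Ch. 7 §A (pp. 234–235).
* [LangeBirkenhake1992] H. Lange, Ch. Birkenhake, *Complex Abelian Varieties*, Ch. 8 §8.1–8.2.
* [Milne2005ShimuraVarieties] J. S. Milne, *Introduction to Shimura varieties*, §6 Thm. 6.11 (pp. 74–75).
* [GortzWedhorn2023] U. Görtz, T. Wedhorn, *Algebraic Geometry II*, Thm. 27.301 (p. 733).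
* [Lan2013PELCompactifications] K.-W. Lan, *Arithmetic compactifications of PEL-type Shimura varieties*, Thm. 1.4.1.11 (p. 91).
* [MumfordAV1970] D. Mumford, *Abelian Varieties*, §13 (p. 125).
-/

set_option autoImplicit false
set_option linter.dupNamespace false

noncomputable section

open CategoryTheory CategoryTheory.Limits AlgebraicGeometry Matrix Topology
open Literature.AlgebraicGeometry
open Literature.AlgebraicGeometry.Motives (SchemeOver ComplexPoints AlgPoints specOver)
open Literature.AlgebraicGeometry.AbelianSchemes (PolarizedAbelianSchemeWithLevel)
open Literature.AlgebraicGeometry.ModuliOfAbelianVarieties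
open Literature.AlgebraicGeometry.ModuliOfAbelianVarieties.SiegelModuli
open Literature.NumberTheory.Automorphic (siegelUpperHalfSpace)
open Literature.NumberTheory.Adeles

namespace Summit.HodgeConjecture.HodgeConjecture.Theorems

namespace UOfF

/-- **U-e FROM (F) AND EQUIDIMENSIONALITY** — the U-e socket of the glue (`glue_core`'s third binder, text verbatim): for
`𝓜_{g,δ,N}` (`0 < g`, `δ` a polarisation type, `3 ≤ N`) and a principal representative `r`, if admissible triples exist at
every `(Z, r)` and `f : 𝔥_g → 𝓜_ℂ(ℂ)` IS the classifying map, then `f` is continuous on `𝔥_g`, open on `𝔥_g` and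
holomorphic in affine algebraic coordinates.  Proof = the (U) head's second-layer composition (B-typ02/B-plan2 `Ue_of`):
EQUIDIM (over `Spec ℚ`) gives `SmoothOfRelativeDimension (g(g+1)/2)` of `𝓜 ⊗_ℚ ℂ → Spec ℂ` by base change; P4 ★
`UeP4OfF.ue_P4_of_F hF` gives local holomorphic period maps reading admissibility; P6 ★ makes them injective with `f ∘ π = id`;
P5 ★ turns local inverses into the three clauses.
[cite: MumfordFogartyKirwan1994, Appendix to Ch. 7 §A (pp. 234–235)] [cite: LangeBirkenhake1992, Ch. 8 §8.1–8.2]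
[cite: Milne2005ShimuraVarieties, §6 Thm. 6.11 pp. 74–75] -/
theorem ue_of_F_of_equidim (hF : lan2013_siegelFineModuliScheme)
    (hE : ∀ (g N : ℕ) (δ : Fin g → ℕ), 0 < g → IsPolarizationType δ → 3 ≤ N →
      ∀ 𝓜 : SiegelFineModuliScheme g N δ, SmoothOfRelativeDimension (g * (g + 1) / 2) 𝓜.M.hom) :
    ∀ (g N : ℕ) (δ : Fin g → ℕ) (_hg : 0 < g) (hδ : IsPolarizationType δ) (_hN : 3 ≤ N)
      (𝓜 : SiegelFineModuliScheme g N δ) (c : (ZMod N)ˣ) (u : finAdeleQˣ) (r : gspFinAdelic δ)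
      (f : Matrix (Fin g) (Fin g) ℂ → ComplexPoints ((Motives.baseChange ℚ ℂ).obj 𝓜.M)),
      haveI : IsLocallyNoetherian (specOver ℚ ℂ).left :=
        inferInstanceAs (IsLocallyNoetherian (Spec (CommRingCat.of ℂ)))
      -- `r = diag(1, u·1)` is a principal representative of the component index `c` (the four `r`-binders of ★ (U) (U3), verbatim)
      (∀ v, Valued.v ((u : finAdeleQ) v) = 1) →
      (u : finAdeleQ) - ((c : ZMod N).val : ℕ) ∈ levelIdeal N →
      r ∈ principalLevelSubgroup δ 1 →
      IsMultiplier (typeFormOver δ finAdeleQ) (r : GL (Fin g ⊕ Fin g) finAdeleQ) u →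
      ((r : GL (Fin g ⊕ Fin g) finAdeleQ) : Matrix (Fin g ⊕ Fin g) (Fin g ⊕ Fin g) finAdeleQ) =
        Matrix.fromBlocks 1 0 0 ((u : finAdeleQ) • (1 : Matrix (Fin g) (Fin g) finAdeleQ)) →
      -- U-a as a hypothesis: an admissible triple exists at every point
      (∀ (Z : Matrix (Fin g) (Fin g) ℂ) (hZ : Z ∈ siegelUpperHalfSpace g),
          ∃ P' : PolarizedAbelianSchemeWithLevel g N δ (specOver ℚ ℂ).left, IsAdmissibleAt hδ r Z hZ P') →
      -- `f` IS the classifying map on `𝔥_g`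
      (∀ (Z : Matrix (Fin g) (Fin g) ℂ) (hZ : Z ∈ siegelUpperHalfSpace g)
          (P' : PolarizedAbelianSchemeWithLevel g N δ (specOver ℚ ℂ).left), IsAdmissibleAt hδ r Z hZ P' →
          f Z = AlgPoints.baseChangeEquiv (algebraMap ℚ ℂ) 𝓜.M (𝓜.classifyingMap (specOver ℚ ℂ) P')) →
      -- the three analytic clauses (★ `SiegelModuliDatum` :489 / :491 / :502 spelling)
        ContinuousOn f (siegelUpperHalfSpace g) ∧
        IsOpenMap ((siegelUpperHalfSpace g).restrict f) ∧
        ∀ (U : ((Motives.baseChange ℚ ℂ).obj 𝓜.M).left.affineOpens)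
          (s : ((Motives.baseChange ℚ ℂ).obj 𝓜.M).left.presheaf.obj (Opposite.op (↑U : ((Motives.baseChange ℚ ℂ).obj 𝓜.M).left.Opens))),
          DifferentiableOn ℂ (fun Z ↦ AlgPoints.evalOrZero (↑U : ((Motives.baseChange ℚ ℂ).obj 𝓜.M).left.Opens) s (f Z))
            (siegelUpperHalfSpace g ∩ f ⁻¹' {P | P.pt ∈ (↑U : ((Motives.baseChange ℚ ℂ).obj 𝓜.M).left.Opens)}) := by
  intro g N δ hg hδ hN 𝓜 c u r f _hu _huc hr _hmult _hmat hUa hf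
  -- EQUIDIM over `Spec ℚ` ⇒ the relative-dimension instance of `𝓜 ⊗_ℚ ℂ → Spec ℂ` (base change; `.hom` is `pullback.snd` by `rfl`)
  haveI hd : SmoothOfRelativeDimension (g * (g + 1) / 2) ((Motives.baseChange ℚ ℂ).obj 𝓜.M).hom := by
    have h : SmoothOfRelativeDimension (g * (g + 1) / 2) 𝓜.M.hom := hE g N δ hg hδ hN 𝓜
    have := smoothOfRelativeDimension_isStableUnderBaseChange (g * (g + 1) / 2)
    exact MorphismProperty.pullback_snd (P := @SmoothOfRelativeDimension (g * (g + 1) / 2)) _ _ h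
  refine siegelClassifyingMap_clauses_of_localInverse g N δ hg hδ hN 𝓜 f ?_
  intro Z₀ hZ₀
  obtain ⟨P₀, hP₀⟩ := hUa Z₀ hZ₀
  obtain ⟨W, π, hW, hx₀, hπ₀, hcont, hhol, hread⟩ :=
    UeP4OfF.ue_P4_of_F hF g N δ hg hδ hN 𝓜 r (g * (g + 1) / 2) hr Z₀ hZ₀ P₀ hP₀
  refine ⟨W, π, hW, ⟨_, hx₀, hπ₀⟩, ?_, ?_, hcont, hhol, ?_⟩
  · rintro _ ⟨x, hx, rfl⟩
    exact (hread x hx).1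
  · intro x hx x' hx' hxx'
    obtain ⟨hZx, P₁, hP₁, hcls₁⟩ := hread x hx
    obtain ⟨hZx', P₂, hP₂, hcls₂⟩ := hread x' hx'
    have hP₂x : IsAdmissibleAt hδ r (π x) hZx P₂ := by
      have key : ∀ (Z : Matrix (Fin g) (Fin g) ℂ) (hZ : Z ∈ siegelUpperHalfSpace g), Z = π x' →
          IsAdmissibleAt hδ r Z hZ P₂ := by
        rintro Z hZ rfl
        exact hP₂
      exact key (π x) hZx hxx'
    have heq := Summit.HodgeConjecture.CorCM.HypDel.UHead.classifyingMap_eq_of_isAdmissibleAt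
      g N δ hg hδ hN 𝓜 r hr (π x) hZx P₁ P₂ hP₁ hP₂x
    rw [← hcls₁, ← hcls₂, heq]
  · intro x hx
    obtain ⟨hZx, P₁, hP₁, hcls₁⟩ := hread x hx
    rw [hf (π x) hZx P₁ hP₁, hcls₁]

/-- **(U) FROM (F) AND EQUIDIMENSIONALITY — `U_of_F (hF) (hE) : siegelModuli_complexUniformisation`**: the complex
uniformisation of the Siegel fine moduli scheme (row I-11 #66 `siegelModuli_complexUniformisation`, [MumfordFogartyKirwan1994]
App. 7A / [Milne2005ShimuraVarieties] Thm. 6.11) from the printed fact (F) `lan2013_siegelFineModuliScheme` and the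
equidimensionality clause EQUIDIM (unfolded binder; [GortzWedhorn2023] Thm. 27.301 prints «its relative dimension is
`g(g+1)/2`»), everything else BY NAME: the glue ★ `glue_core hF`, the U-a half ★ `Ua_holds_of_residual` at ★ M13
`U_a3_residual_of_M13` (no binder), and `ue_of_F_of_equidim` above.  The cell's (U) head `U_of (hF) (hM13) (hE)` with
`hM13` instantiated — its tree home.
[cite: MumfordFogartyKirwan1994, Appendix to Ch. 7 §A (pp. 234–235)] [cite: Milne2005ShimuraVarieties, §6 Thm. 6.11 pp. 74–75]
[cite: GortzWedhorn2023, Thm. 27.301 (p. 733)] [cite: MumfordAV1970, §13 (p. 125)] -/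
theorem U_of_F (hF : lan2013_siegelFineModuliScheme)
    (hE : ∀ (g N : ℕ) (δ : Fin g → ℕ), 0 < g → IsPolarizationType δ → 3 ≤ N →
      ∀ 𝓜 : SiegelFineModuliScheme g N δ, SmoothOfRelativeDimension (g * (g + 1) / 2) 𝓜.M.hom) :
    siegelModuli_complexUniformisation :=
  Summit.HodgeConjecture.CorCM.HypDel.UHead.glue_core hF
    (UHead.Ua_holds_of_residual Motives.AbelianVariety.U_a3_residual_of_M13)
    (ue_of_F_of_equidim hF hE)

/-- **(U) FROM THE SINGLE PRINTED FACT (F′) — `U_of_relDim_F (hF′) : siegelModuli_complexUniformisation`** (director s164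
Y-E2 head; the 24835 registry v5.2 reads `stub_U := UOfF.U_of_relDim_F stub_F'`): (F′) ★ `lan2013_siegelFineModuliScheme_relDim`
— the Siegel moduli functor of type `δ` at principal level `N ≥ 3` is represented over `ℚ` by a smooth quasi-projective scheme OF
RELATIVE DIMENSION `g(g+1)/2` with a quasi-projective universal family ([Lan2013PELCompactifications] Thm. 1.4.1.11 with
[GortzWedhorn2023] Thm. 27.301 for the numeral) — gives (F) by ★ `lan2013_of_relDim` and the equidimensionality binder of
`U_of_F` by ★ `smoothOfRelativeDimension_of_relDim` (transport of the relative dimension to EVERY fine moduli scheme along the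
uniqueness isomorphism ★ `SiegelFineModuliScheme.isoOfClassify`).
[cite: GortzWedhorn2023, Thm. 27.301 (p. 733)] [cite: Lan2013PELCompactifications, Thm. 1.4.1.11 (p. 91)] [cite: MumfordFogartyKirwan1994, Appendix to Ch. 7 §A (pp. 234–235)]
[cite: Milne2005ShimuraVarieties, §6 Thm. 6.11 pp. 74–75] -/
theorem U_of_relDim_F (hF' : lan2013_siegelFineModuliScheme_relDim) : siegelModuli_complexUniformisation :=
  U_of_F (lan2013_of_relDim hF') fun _g _N _δ hg hδ hN 𝓜 ↦ smoothOfRelativeDimension_of_relDim hF' hg hδ hN 𝓜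

end UOfF

end Summit.HodgeConjecture.HodgeConjecture.Theorems

end
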